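import Mathlib
import HarnessLib

/-!
# The Riemann integral: Chebyshev's inequality and the mean-value theorems (Davis–Rabinowitz 1984, Sect. 1.5)

Davis–Rabinowitz, *Methods of Numerical Integration* (2nd ed., 1984), Sect. 1.5 "The Riemann Integral" (held OCR
PDF pp. 12–13) collects the working properties of `∫_a^b f`: Riemann sums and `Δ → 0` (1.5.1)–(1.5.3), linearity
and orientation (1.5.4)–(1.5.9), positivity, and then:

* **(1.5.10)** (Chebyshev) if `f` and `g` are both increasing or both decreasing on `[a, b]`, then
  `(b - a) ∫_a^b f g ≥ ∫_a^b f · ∫_a^b g`; "if `f` and `g` are of opposite type, the inequality is reversed";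
* (1.5.11)–(1.5.14) `|∫ f| ≤ ∫ |f|`, Schwarz, Hölder, Minkowski;
* **(1.5.15)** First Mean-Value Theorem: `f` continuous on `[a, b]` ⇒ `∫_a^b f = (b - a) f(ξ)` for some `a < ξ < b`;
* **(1.5.16)–(1.5.17)** `m ≤ f ≤ M` on `[a, b]` ⇒ `m(b - a) ≤ ∫_a^b f ≤ M(b - a)`;
* **(1.5.18)** Generalized Mean-Value Theorem: `f, g` continuous on `[a, b]`, `g ≥ 0` ⇒
  `∫_a^b f g = f(ξ) ∫_a^b g` for some `ξ`;
* (1.5.19)–(1.5.21) the fundamental theorem and integration by parts; (1.5.22)–(1.5.23) the special Riemann sums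
  `h Σ_{k=1}^n f(a + kh)`, `h Σ_{k=0}^{n-1} f(a + kh)`.

What is formalised (Mathlib only): (1.5.10) in both orientations (`integral_mul_integral_le_of_monotoneOn`,
`integral_mul_integral_le_of_antitoneOn`, and the reversed `mul_integral_mul_le_of_monotoneOn_antitoneOn`), proved
WITHOUT Fubini from the positivity of the iterated integral `∫_a^b ∫_a^b (f x - f y)(g x - g y) dy dx`; (1.5.17)
(`mul_sub_le_integral_of_forall_le`, `integral_le_mul_sub_of_forall_le`); (1.5.15) with `ξ` in the OPEN
interval, from the Lagrange mean-value theorem applied to `x ↦ ∫_a^x f` (`exists_integral_eq_mul_Ioo`; closed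
form `exists_integral_eq_mul_Icc`).
Not restated: (1.5.18) is ALREADY in the tree as `Literature.Analysis.Quadrature.exists_integral_mul_eq_mul_integral`
(`MidpointTrapezoidPeanoKernel.lean`, filed for Sect. 4.3 (4.3.13): `ξ ∈ [a, b]`, weight `w ≥ 0`; companion
`exists_integral_mul_eq_mul_integral_of_nonpos` in `SimpsonRulePeanoKernel.lean`) — use it by name;
(1.5.11)–(1.5.14), (1.5.19)–(1.5.21) are Mathlib (`intervalIntegral.abs_integral_le_integral_abs`,
`integral_mul_le_Lp_mul_Lq_of_nonneg`, `intervalIntegral.integral_eq_sub_of_hasDerivAt`,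
`intervalIntegral.integral_mul_deriv_eq_deriv_mul`), and the Riemann sums (1.5.22)–(1.5.23) with their convergence
are `Literature.Analysis.Quadrature.rightRiemannSum` / `leftRiemannSum` (`RectangularRuleError.lean`, Sect. 2.1).
-/

open MeasureTheory Set intervalIntegral

namespace Literature.Analysis.Quadrature

variable {f g : ℝ → ℝ} {a b : ℝ}

/-! ## (1.5.16)–(1.5.17): bounds -/

/-- **(1.5.17), lower half**: `m ≤ f` on `[a, b]` (`a ≤ b`, `f` integrable) ⇒ `m (b - a) ≤ ∫_a^b f`.
[cite: DavisRabinowitz1984, Sect. 1.5 (1.5.16)-(1.5.17)] -/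
theorem mul_sub_le_integral_of_forall_le (hab : a ≤ b) (hfi : IntervalIntegrable f volume a b) {m : ℝ}
    (hm : ∀ x ∈ Icc a b, m ≤ f x) : m * (b - a) ≤ ∫ x in a..b, f x := by
  have h := intervalIntegral.integral_mono_on hab intervalIntegrable_const hfi hm
  simpa [intervalIntegral.integral_const, mul_comm] using h

/-- **(1.5.17), upper half**: `f ≤ M` on `[a, b]` (`a ≤ b`, `f` integrable) ⇒ `∫_a^b f ≤ M (b - a)`.
[cite: DavisRabinowitz1984, Sect. 1.5 (1.5.16)-(1.5.17)] -/
theorem integral_le_mul_sub_of_forall_le (hab : a ≤ b) (hfi : IntervalIntegrable f volume a b) {M : ℝ}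
    (hM : ∀ x ∈ Icc a b, f x ≤ M) : (∫ x in a..b, f x) ≤ M * (b - a) := by
  have h := intervalIntegral.integral_mono_on hab hfi intervalIntegrable_const hM
  simpa [intervalIntegral.integral_const, mul_comm] using h

/-! ## (1.5.10): Chebyshev's inequality for similarly ordered functions -/

/-- The iterated integral behind (1.5.10): for `f, g` continuous on `[a, b]`,
`∫_a^b ∫_a^b (f x - f y)(g x - g y) dy dx = 2 [ (b - a) ∫ f g - ∫ f ∫ g ]` (no Fubini: inner and outer integrals
are expanded by linearity). [cite: DavisRabinowitz1984, Sect. 1.5 (1.5.10)] -/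
theorem integral_integral_sub_mul_sub (hab : a ≤ b) (hf : ContinuousOn f (Icc a b))
    (hg : ContinuousOn g (Icc a b)) :
    (∫ x in a..b, ∫ y in a..b, (f x - f y) * (g x - g y)) =
      2 * ((b - a) * (∫ x in a..b, f x * g x) - (∫ x in a..b, f x) * ∫ x in a..b, g x) := by
  have hfi : IntervalIntegrable f volume a b := hf.intervalIntegrable_of_Icc hab
  have hgi : IntervalIntegrable g volume a b := hg.intervalIntegrable_of_Icc hab
  have hfgi : IntervalIntegrable (fun x => f x * g x) volume a b := (hf.mul hg).intervalIntegrable_of_Icc hab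
  set F := ∫ x in a..b, f x with hF
  set G := ∫ x in a..b, g x with hG
  set P := ∫ x in a..b, f x * g x with hP
  -- inner integral, for every x
  have inner : ∀ x, (∫ y in a..b, (f x - f y) * (g x - g y)) =
      (b - a) * (f x * g x) - f x * G - g x * F + P := by
    intro x
    have e : (fun y => (f x - f y) * (g x - g y)) =
        fun y => ((f x * g x - f x * g y) - g x * f y) + f y * g y := by
      funext y; ring
    rw [e, intervalIntegral.integral_add ?_ hfgi, intervalIntegral.integral_sub ?_ (hfi.const_mul _),
      intervalIntegral.integral_sub intervalIntegrable_const (hgi.const_mul _), intervalIntegral.integral_const,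
      intervalIntegral.integral_const_mul, intervalIntegral.integral_const_mul]
    · simp only [smul_eq_mul]; ring
    · exact intervalIntegrable_const.sub (hgi.const_mul _)
    · exact (intervalIntegrable_const.sub (hgi.const_mul _)).sub (hfi.const_mul _)
  simp_rw [inner]
  rw [intervalIntegral.integral_add ?_ intervalIntegrable_const, intervalIntegral.integral_sub ?_ (hgi.mul_const _),
    intervalIntegral.integral_sub (hfgi.const_mul _) (hfi.mul_const _), intervalIntegral.integral_const_mul,
    intervalIntegral.integral_mul_const, intervalIntegral.integral_mul_const, intervalIntegral.integral_const]
  · simp only [smul_eq_mul]; ring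
  · exact (hfgi.const_mul _).sub (hfi.mul_const _)
  · exact ((hfgi.const_mul _).sub (hfi.mul_const _)).sub (hgi.mul_const _)

/-- **(1.5.10)** (Chebyshev): `f, g` continuous and both increasing on `[a, b]` (`a ≤ b`) ⇒
`∫_a^b f · ∫_a^b g ≤ (b - a) ∫_a^b f g`. [cite: DavisRabinowitz1984, Sect. 1.5 (1.5.10)] -/
theorem integral_mul_integral_le_of_monotoneOn (hab : a ≤ b) (hf : ContinuousOn f (Icc a b))
    (hg : ContinuousOn g (Icc a b)) (hfm : MonotoneOn f (Icc a b)) (hgm : MonotoneOn g (Icc a b)) :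
    (∫ x in a..b, f x) * (∫ x in a..b, g x) ≤ (b - a) * ∫ x in a..b, f x * g x := by
  have hnn : 0 ≤ ∫ x in a..b, ∫ y in a..b, (f x - f y) * (g x - g y) := by
    refine intervalIntegral.integral_nonneg hab fun x hx => intervalIntegral.integral_nonneg hab fun y hy => ?_
    rcases le_total x y with hxy | hxy
    · exact mul_nonneg_of_nonpos_of_nonpos (sub_nonpos.2 (hfm hx hy hxy)) (sub_nonpos.2 (hgm hx hy hxy))
    · exact mul_nonneg (sub_nonneg.2 (hfm hy hx hxy)) (sub_nonneg.2 (hgm hy hx hxy))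
  rw [integral_integral_sub_mul_sub hab hf hg] at hnn
  linarith

/-- **(1.5.10)**, both decreasing: the same inequality. [cite: DavisRabinowitz1984, Sect. 1.5 (1.5.10)] -/
theorem integral_mul_integral_le_of_antitoneOn (hab : a ≤ b) (hf : ContinuousOn f (Icc a b))
    (hg : ContinuousOn g (Icc a b)) (hfm : AntitoneOn f (Icc a b)) (hgm : AntitoneOn g (Icc a b)) :
    (∫ x in a..b, f x) * (∫ x in a..b, g x) ≤ (b - a) * ∫ x in a..b, f x * g x := by
  have hnn : 0 ≤ ∫ x in a..b, ∫ y in a..b, (f x - f y) * (g x - g y) := by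
    refine intervalIntegral.integral_nonneg hab fun x hx => intervalIntegral.integral_nonneg hab fun y hy => ?_
    rcases le_total x y with hxy | hxy
    · exact mul_nonneg (sub_nonneg.2 (hfm hx hy hxy)) (sub_nonneg.2 (hgm hx hy hxy))
    · exact mul_nonneg_of_nonpos_of_nonpos (sub_nonpos.2 (hfm hy hx hxy)) (sub_nonpos.2 (hgm hy hx hxy))
  rw [integral_integral_sub_mul_sub hab hf hg] at hnn
  linarith

/-- **(1.5.10)**, opposite type ("the inequality is reversed"): `f` increasing, `g` decreasing on `[a, b]` ⇒
`(b - a) ∫_a^b f g ≤ ∫_a^b f · ∫_a^b g`. [cite: DavisRabinowitz1984, Sect. 1.5 (1.5.10)] -/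
theorem mul_integral_mul_le_of_monotoneOn_antitoneOn (hab : a ≤ b) (hf : ContinuousOn f (Icc a b))
    (hg : ContinuousOn g (Icc a b)) (hfm : MonotoneOn f (Icc a b)) (hgm : AntitoneOn g (Icc a b)) :
    (b - a) * (∫ x in a..b, f x * g x) ≤ (∫ x in a..b, f x) * ∫ x in a..b, g x := by
  have hnp : (∫ x in a..b, ∫ y in a..b, (f x - f y) * (g x - g y)) ≤ 0 := by
    rw [← neg_nonneg, ← intervalIntegral.integral_neg]
    refine intervalIntegral.integral_nonneg hab fun x hx => ?_
    rw [← intervalIntegral.integral_neg]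
    refine intervalIntegral.integral_nonneg hab fun y hy => ?_
    rcases le_total x y with hxy | hxy
    · have := mul_nonpos_of_nonpos_of_nonneg (sub_nonpos.2 (hfm hx hy hxy)) (sub_nonneg.2 (hgm hx hy hxy))
      linarith
    · have := mul_nonpos_of_nonneg_of_nonpos (sub_nonneg.2 (hfm hy hx hxy)) (sub_nonpos.2 (hgm hy hx hxy))
      linarith
  rw [integral_integral_sub_mul_sub hab hf hg] at hnp
  linarith

/-! ## (1.5.15): the first mean-value theorem -/

/-- **(1.5.15)** First Mean-Value Theorem, with `ξ` in the OPEN interval as in the text: `f` continuous on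
`[a, b]`, `a < b` ⇒ `∫_a^b f = (b - a) f(ξ)` for some `a < ξ < b` (Lagrange's theorem for `x ↦ ∫_a^x f`).
[cite: DavisRabinowitz1984, Sect. 1.5 (1.5.15)] -/
theorem exists_integral_eq_mul_Ioo (hab : a < b) (hf : ContinuousOn f (Icc a b)) :
    ∃ ξ ∈ Ioo a b, ∫ x in a..b, f x = (b - a) * f ξ := by
  have hfi : IntervalIntegrable f volume a b := hf.intervalIntegrable_of_Icc hab.le
  set F : ℝ → ℝ := fun x => ∫ t in a..x, f t with hF
  have hFc : ContinuousOn F (Icc a b) := by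
    have hint : IntegrableOn f (uIcc a b) volume := by
      rw [uIcc_of_le hab.le]; exact hf.integrableOn_Icc
    have h := intervalIntegral.continuousOn_primitive_interval (μ := volume) (f := f) (a := a) (b := b) hint
    rwa [uIcc_of_le hab.le] at h
  have hFd : ∀ x ∈ Ioo a b, HasDerivAt F (f x) x := by
    intro x hx
    have hx' : Icc a b ∈ nhds x := Icc_mem_nhds hx.1 hx.2
    refine intervalIntegral.integral_hasDerivAt_right (hfi.mono_set ?_) ?_ (hf.continuousAt hx')
    · rw [uIcc_of_le hab.le, uIcc_of_le hx.1.le]; exact Icc_subset_Icc_right hx.2.le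
    · exact (hf.mono Ioo_subset_Icc_self).stronglyMeasurableAtFilter isOpen_Ioo _ hx
  obtain ⟨ξ, hξ, hslope⟩ := exists_hasDerivAt_eq_slope F (fun x => f x) hab hFc hFd
  refine ⟨ξ, hξ, ?_⟩
  have hFa : F a = 0 := by simp [hF]
  have hba : b - a ≠ 0 := (sub_pos.2 hab).ne'
  rw [hFa, sub_zero] at hslope
  -- hslope : f ξ = F b / (b - a)
  have : F b = ∫ x in a..b, f x := rfl
  rw [← this, hslope]
  field_simp

/-- **(1.5.15)**, closed form (`a ≤ b` allowed): `∫_a^b f = (b - a) f(ξ)` for some `ξ ∈ [a, b]`.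
[cite: DavisRabinowitz1984, Sect. 1.5 (1.5.15)] -/
theorem exists_integral_eq_mul_Icc (hab : a ≤ b) (hf : ContinuousOn f (Icc a b)) :
    ∃ ξ ∈ Icc a b, ∫ x in a..b, f x = (b - a) * f ξ := by
  rcases hab.eq_or_lt with rfl | hlt
  · exact ⟨a, left_mem_Icc.2 le_rfl, by simp⟩
  · obtain ⟨ξ, hξ, h⟩ := exists_integral_eq_mul_Ioo hlt hf
    exact ⟨ξ, Ioo_subset_Icc_self hξ, h⟩

end Literature.Analysis.Quadrature
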